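import Summits.BirchSwinnertonDyer.Rank1Residual.ManinAdditive.TwistOrbitIndexEngineAtTwo
import Literature.NumberTheory.EllipticCurves.QuadraticTwistAtTwoMinimalModelProofs
import HarnessLib
import HarnessLib.Audit.Tags

/-!
# §29b (g6) MANIN NEAR-INVARIANCE AT `2` along commuting optimal `χ±8`-orbits — the `p = 2` twin of §27
# (cell `bsd-f2-manin`, seat `-an`, analytic / period-lattice lens)

The §27 engine at an odd additive prime `p` (`TwistOrbitManinNearInvariance`) has an exact twin at `p = 2` on
SAME-CONDUCTOR `χ₈` / `χ₋₈` orbits (`d = ±2`, `2⁶ ∣ N = N′`; in Cremona's range these are the levels with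
`v₂(N) ∈ {7, 8}`):

* ARITHMETIC INPUT (new, elementary, proved here): a globally minimal equation with ADDITIVE reduction at `2`
  has `a₁, a₃` even (`even_a₁_and_even_a₃_of_additiveAtTwo`; contrapositive of Silverman *AEC* VII.5.1 via the
  tree's parity lemmas `odd_c₄_of_odd_a₁`, `odd_Δ_of_even_a₁_of_odd_a₃`), and then the HALF model
  `(0, e(α² + a₂), 0, e²(a₄ + 2αβ), e³(β² + a₆))` (`a₁ = 2α`, `a₃ = 2β`) of `W ⊗ e` is integral with
  discriminant `e⁶Δ_min(W)`, so `v_p(Δ_min(W ⊗ e)) ≤ v_pΔ_min(W) + 6·v_p(e)` — at `p = 2`, `e = ±2` this is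
  `+6` instead of the `+18` of the crude `4e`-model (§27 `twistIntModel`).  Hence on a `±2`-twist pair with BOTH
  curves additive at `2`: `|v₂Δ′_min − v₂Δ_min| ≤ 6` (`padicValInt_minimalDiscriminantInt_twoTwist_le`).
  PLACEMENT (refuter-2 R-an-21, 2026-08-27T22:50Z): this discriminant lemma is IN PRINT — it is the `d ≡ 2 (mod 4)`
  clause of Connell's proposition AS CORRECTED BY PAL (Pal 2012, Prop. 2.4: with `w = d/2` and the 2-adic
  signature `(v₂c₄, v₂c₆, v₂Δ)` of the minimal `E`, «signature `(0,0,c)` ⇒ `v₂Δ′ = v₂Δ + 18`; signature `(6,9,c ≥ 18)`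
  and `2⁻⁹c₆w ≡ −1 (mod 4)` ⇒ `v₂Δ′ = v₂Δ − 18`; `v₂c₄ ∈ {4,5}` or `v₂c₆ ∈ {3,5,7}` or signature `(a,6,6)`, `a ≥ 6`,
  with `2⁻⁶c₆w ≡ −1 (mod 4)` ⇒ `v₂Δ′ = v₂Δ + 6`; otherwise `v₂Δ′ = v₂Δ − 6»; signature `(0,0,·)` means `E`
  semistable at `2`, so two ADDITIVE sides force `±6` with the SIGN in closed form), and its Kodaira-resolved form is
  Barrios–Roy–Sahajpal–Tallana–Tobin–Wiersema 2025, Thm. 5.1 with Table `localdata-deven` (e.g. `III → III*`: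
  `(δ, δ^d) = (k, k + 6)`, `(f, f^d) = (k − 1, k − 1)`, `k ∈ {8, 9}`; `II → I₂*`: `(7, 13)`, `(7, 7)`).  Grade: KNOWN
  (statement in print; the Lean proof here is ours and Kraus-free, via the parity lemma; the printed SIGN rule is not
  formalised in this file).
* LATTICE INPUT (`TwistOrbitIndexEngineAtTwo`, §29a): on a commuting optimal `±2`-pair with `2⁶ ∣ N = N′`,
  `deg′ = 2·deg ∧ 12·v₂(c′) + v₂Δ′ = 12·v₂(c) + 6 + v₂Δ` or `2·deg′ = deg ∧ 12·v₂(c′) + 6 + v₂Δ′ = 12·v₂(c) + v₂Δ`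
  (half-Gauss-sum steps at `2` + the index engine with `‖g(χ)/2‖² = 2`).
* OUTPUT (PROVED, unconditional): `twoTwist_optimal_commuting_manin_near_invariance` — on every commuting
  optimal `χ±8`-pair `|v₂(c′) − v₂(c)| ≤ 1`, the minimal discriminant jumps by EXACTLY `6` at `2`, and
  `v₂(c′) = v₂(c)` iff degree and discriminant move together.  Typed leaves: E-an-32₂ `TwoTwistCommutingOrbitManinValNear d` with its `_holds`
  (here); E-an-35 `TwoTwistCommutingOrbitDiscrDirection d` (the direction law at `2`; census TWISTCENSUS2 v1:
  28 112 / 28 112 commuting same-conductor `χ₈` rows and 28 112 / 28 112 `χ₋₈` rows obey) and E-an-36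
  `TwoTwistCommutingOrbitManinValEq d` (2-adic Manin invariance on these pairs) live in the leaf file
  `TwoTwistCommutingOrbitDiscrDirection.lean`, PROVED equivalent in `TwistOrbitManinNearInvarianceAtTwoEdges.lean`
  (`twoTwistCommutingOrbitManinValEq_iff_discrDirection`).  KODAIRA READING (memo §47): at `v₂(N) = 7` the `±2`-twist swaps `II ↔ I₂*` and
  `III ↔ III*`, at `v₂(N) = 8` only `III ↔ III*` occurs; the direction law says the STARRED member (six more
  components) has the DOUBLED degree.

RELATION TO THE g3 RESULTS AT `2` (`TwistOrbitAtTwoA3EvenDegree`, `TwistOrbitAtTwoExactDegree`, E-an-18r / E-an-22):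
those give the Manin chain `c′ ∣ c ∣ d·c′` on commuting `χ±8`-pairs UNDER THE MODEL PROVISO `Δ(W′) = d⁶Δ(W)` (which
by the present theorem is exactly the degree-UP direction); here there is NO proviso — global minimality of both
equations plus the parity lemma replace it — and the output is the full two-direction dichotomy with the exact
discriminant jump, i.e. the `p = 2` analogue of the passage §23/§24 → §27 at odd `p`.  DATA SHADOW of the sharp
twist-discriminant lemma (TWISTCENSUS2 v1, ALL `±2` rows, HOME `an/direction-test-at2-g6.txt`): `|v₂Δ′_min − v₂Δ_min| = 6`
on every row with both conductors additive at `2` (`v₂N, v₂N′ ≥ 2`: 1 732 596 rows), `18` only when the twist is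
semistable (`v₂N′ ≤ 1`: 55 702 rows, plus 7 042 such rows with `6`).

Nothing conjectural is asserted; no summit statement is touched; nothing here bears on the truth of BSD.
[cite: SilvermanAEC2009, VII.1, VII.5 Prop. 5.1, X.5 Cor. 5.4] [cite: Stevens1989, Lemma (5.4) p. 97]
[cite: Watkins2002, §2.1] [cite: Pal2012, Prop. 2.4 (d ≡ 2 mod 4 clause)] [cite: BarriosEtAl2025, Thm. 5.1, Table localdata-deven]
[cite: Connell1999, §5.7.3]
-/

noncomputable section

open scoped MatrixGroups ModularForm

open CongruenceSubgroup WeierstrassCurve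
  Literature.NumberTheory.DiophantineGeometry
  Literature.NumberTheory.EllipticCurves
  Literature.NumberTheory.EllipticCurves.ModularForms

namespace Summit.BirchSwinnertonDyer.Rank1Residual.ManinAdditive

section NearInvarianceAtTwo

/-! ### Arithmetic input: additive at `2` ⟹ `a₁, a₃` even ⟹ the half twist model is integral -/

/-- **Additive reduction at `2` ⟹ `a₁` and `a₃` of the minimal equation are even** (if `a₁` is odd
then `c₄` is odd and the reduction is good or multiplicative; if `a₁` is even and `a₃` odd then `Δ` is
odd and the reduction is good).  Silverman *AEC* VII.5.1. -/
theorem even_a₁_and_even_a₃_of_additiveAtTwo (W : WeierstrassCurve ℚ) [W.IsElliptic]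
    [W.IsGloballyMinimal] (hng : ¬ W.HasGoodReductionAtPrime 2)
    (hnm : ¬ W.HasMultiplicativeReductionAtPrime 2) :
    Even (integralModelInt W).a₁ ∧ Even (integralModelInt W).a₃ := by
  set M : WeierstrassCurve ℤ := integralModelInt W with hM
  have hWM : M.map (Int.castRingHom ℚ) = W := map_integralModelInt W
  set v : IsDedekindDomain.HeightOneSpectrum (NumberField.RingOfIntegers ℚ) :=
    (Rat.HeightOneSpectrum.primesEquiv (R := NumberField.RingOfIntegers ℚ)).symm ⟨2, Nat.prime_two⟩
    with hv
  have hpv : Rat.HeightOneSpectrum.primesEquiv v = ⟨2, Nat.prime_two⟩ :=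
    (Rat.HeightOneSpectrum.primesEquiv (R := NumberField.RingOfIntegers ℚ)).apply_symm_apply _
  have hgen : Rat.HeightOneSpectrum.natGenerator v = 2 := congrArg Subtype.val hpv
  have hgen2 : (Rat.HeightOneSpectrum.natGenerator v : ℤ) = 2 := by exact_mod_cast hgen
  have hmin : W.IsMinimalAt v := IsGloballyMinimal.isMinimal v
  have hg_of : v.valuation ℚ W.Δ = 1 → W.HasGoodReductionAtPrime 2 := fun h ↦ by
    have h' := W.hasGoodReductionAtPrime_iff_hasGoodReductionAt_ringOfIntegers v
    rw [hpv] at h'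
    exact h'.mpr ((hasGoodReductionAt_iff_of_isMinimalAt hmin).mpr h)
  have hm_of : v.valuation ℚ W.Δ < 1 → v.valuation ℚ W.c₄ = 1 →
      W.HasMultiplicativeReductionAtPrime 2 := fun h1 h2 ↦ by
    have h' := W.hasMultiplicativeReductionAtPrime_iff_hasMultiplicativeReductionAt_ringOfIntegers v
    rw [hpv] at h'
    exact h'.mpr ((hasMultiplicativeReductionAt_iff_of_isMinimalAt hmin).mpr ⟨h1, h2⟩)
  have hΔle : v.valuation ℚ W.Δ ≤ 1 := by
    rw [← hWM, map_Δ, eq_intCast]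
    exact Rat.valuation_intCast_le_one v _
  by_cases h₁ : Odd M.a₁
  · exfalso
    have hc₄ : ¬ (2 : ℤ) ∣ M.c₄ := odd_c₄_of_odd_a₁ M h₁
    have hvc₄ : v.valuation ℚ W.c₄ = 1 := by
      rw [← hWM, map_c₄, eq_intCast]
      exact Literature.NumberTheory.GaloisRepresentations.Rat.valuation_intCast_eq_one v
        (by rw [hgen2]; exact hc₄)
    rcases hΔle.lt_or_eq with hlt | heq
    · exact hnm (hm_of hlt hvc₄)
    · exact hng (hg_of heq)
  · have h₁' : Even M.a₁ := Int.not_odd_iff_even.mp h₁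
    refine ⟨h₁', ?_⟩
    by_contra h₃
    rw [Int.not_even_iff_odd] at h₃
    have hΔ : ¬ (2 : ℤ) ∣ M.Δ := odd_Δ_of_even_a₁_of_odd_a₃ M h₁' h₃
    have hvΔ : v.valuation ℚ W.Δ = 1 := by
      rw [← hWM, map_Δ, eq_intCast]
      exact Literature.NumberTheory.GaloisRepresentations.Rat.valuation_intCast_eq_one v
        (by rw [hgen2]; exact hΔ)
    exact hng (hg_of hvΔ)

/-- The HALF twisted equation `(0, e(α² + a₂), 0, e²(a₄ + 2αβ), e³(β² + a₆))` of an integral equation `M`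
with `a₁ = 2α`, `a₃ = 2β`: an integral model of `M ⊗ e` with discriminant `e⁶ Δ(M)` (the `u = 2` descent of
§27's `twistIntModel M e`, whose discriminant is `(4e)⁶ Δ(M)`). -/
def twistIntModelEven (M : WeierstrassCurve ℤ) (α β e : ℤ) : WeierstrassCurve ℤ :=
  ⟨0, e * (α ^ 2 + M.a₂), 0, e ^ 2 * (M.a₄ + 2 * α * β), e ^ 3 * (β ^ 2 + M.a₆)⟩

/-- `twistIntModelEven (integralModelInt W) α β e` is a `ℤ`-model of `W ⊗ e` when `a₁ = 2α`, `a₃ = 2β`. -/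
theorem baseChange_twistIntModelEven (W : WeierstrassCurve ℚ) [W.IsGloballyMinimal] {α β : ℤ}
    (h₁ : (integralModelInt W).a₁ = 2 * α) (h₃ : (integralModelInt W).a₃ = 2 * β) (e : ℤ) :
    (twistIntModelEven (integralModelInt W) α β e).baseChange ℚ = W.quadraticTwist (e : ℚ) := by
  set M : WeierstrassCurve ℤ := integralModelInt W with hM
  have hWM : M.map (Int.castRingHom ℚ) = W := map_integralModelInt W
  have hb₂ : W.b₂ = (M.b₂ : ℚ) := by rw [← hWM, map_b₂, eq_intCast]
  have hb₄ : W.b₄ = (M.b₄ : ℚ) := by rw [← hWM, map_b₄, eq_intCast]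
  have hb₆ : W.b₆ = (M.b₆ : ℚ) := by rw [← hWM, map_b₆, eq_intCast]
  have eb₂ : M.b₂ = 4 * (α ^ 2 + M.a₂) := by rw [WeierstrassCurve.b₂, h₁]; ring
  have eb₄ : M.b₄ = 2 * (M.a₄ + 2 * α * β) := by rw [WeierstrassCurve.b₄, h₁, h₃]; ring
  have eb₆ : M.b₆ = 4 * (β ^ 2 + M.a₆) := by rw [WeierstrassCurve.b₆, h₃]; ring
  ext
  · simp [twistIntModelEven, WeierstrassCurve.baseChange, quadraticTwist_a₁]
  · simp only [twistIntModelEven, WeierstrassCurve.baseChange, map_a₂, quadraticTwist_a₂, hb₂, eb₂,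
      algebraMap_int_eq, eq_intCast]
    push_cast; ring
  · simp [twistIntModelEven, WeierstrassCurve.baseChange, quadraticTwist_a₃]
  · simp only [twistIntModelEven, WeierstrassCurve.baseChange, map_a₄, quadraticTwist_a₄, hb₄, eb₄,
      algebraMap_int_eq, eq_intCast]
    push_cast; ring
  · simp only [twistIntModelEven, WeierstrassCurve.baseChange, map_a₆, quadraticTwist_a₆, hb₆, eb₆,
      algebraMap_int_eq, eq_intCast]
    push_cast; ring

/-- **Minimal discriminants along a quadratic twist, even case.** If `W′ ≅ W ⊗ e` over `ℚ` (`e ∈ ℤ ∖ {0}`),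
both equations globally minimal and `a₁, a₃` of `W`'s minimal equation EVEN, then for every prime `p`:
`v_p(Δ_min W′) ≤ v_p(Δ_min W) + 6·v_p(e)` (Silverman *AEC* VII.1: a minimal equation minimises `v_p(Δ)`
among integral ones; the half model has discriminant `e⁶Δ_min(W)`). -/
theorem padicValInt_minimalDiscriminantInt_le_of_smul_quadraticTwist_of_even
    {W W' : WeierstrassCurve ℚ} [W.IsElliptic] [W.IsGloballyMinimal] [W'.IsElliptic]
    [W'.IsGloballyMinimal] (h₁ : Even (integralModelInt W).a₁) (h₃ : Even (integralModelInt W).a₃)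
    {e : ℤ} (he : e ≠ 0) (C : VariableChange ℚ)
    (hC : C • W.quadraticTwist (e : ℚ) = W') (p : ℕ) [hp : Fact p.Prime] :
    padicValInt p W'.minimalDiscriminantInt ≤
      padicValInt p W.minimalDiscriminantInt + 6 * padicValInt p e := by
  obtain ⟨α, hα⟩ := h₁
  obtain ⟨β, hβ⟩ := h₃
  set v : IsDedekindDomain.HeightOneSpectrum ℤ :=
    (Rat.HeightOneSpectrum.primesEquiv (R := ℤ)).symm ⟨p, hp.out⟩ with hvdef
  have hv : Rat.HeightOneSpectrum.natGenerator v = p :=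
    congrArg Subtype.val ((Rat.HeightOneSpectrum.primesEquiv (R := ℤ)).apply_symm_apply ⟨p, hp.out⟩)
  set X : WeierstrassCurve ℤ := twistIntModelEven (integralModelInt W) α β e with hXdef
  have hX : X.baseChange ℚ = W.quadraticTwist (e : ℚ) :=
    baseChange_twistIntModelEven W (by rw [hα]; ring) (by rw [hβ]; ring) e
  have hC₃ : C⁻¹ • W' = X.baseChange ℚ := by rw [hX, ← hC, inv_smul_smul]
  have hmin : W'.IsMinimalAt v := IsGloballyMinimal.isMinimalAt_int W' v
  have hint : (C⁻¹ • W').IsIntegralAt v := by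
    rw [hC₃]; exact isIntegralAt_baseChange_int v X
  have hle := valuation_Δ_smul_le_of_isMinimalAt v hmin C⁻¹ hint
  rw [hC₃, hX, quadraticTwist_Δ, ← cast_minimalDiscriminantInt W, ← cast_minimalDiscriminantInt W']
    at hle
  have hΔ0 : W.minimalDiscriminantInt ≠ 0 := W.minimalDiscriminantInt_ne_zero
  have hΔ0' : W'.minimalDiscriminantInt ≠ 0 := W'.minimalDiscriminantInt_ne_zero
  have hcast : ((e : ℚ)) ^ 6 * (W.minimalDiscriminantInt : ℚ) =
      ((e ^ 6 * W.minimalDiscriminantInt : ℤ) : ℚ) := by push_cast; ring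
  have hne1 : ((e ^ 6 * W.minimalDiscriminantInt : ℤ) : ℚ) ≠ 0 := by
    exact_mod_cast mul_ne_zero (pow_ne_zero _ he) hΔ0
  have hne2 : (W'.minimalDiscriminantInt : ℚ) ≠ 0 := by exact_mod_cast hΔ0'
  rw [hcast, Rat.HeightOneSpectrum.valuation_eq_exp_neg_padicValRat v hne1,
    Rat.HeightOneSpectrum.valuation_eq_exp_neg_padicValRat v hne2, hv, WithZero.exp_le_exp,
    neg_le_neg_iff, padicValRat.of_int, padicValRat.of_int, Nat.cast_le] at hle
  rw [padicValInt.mul (pow_ne_zero _ he) hΔ0, padicValInt_pow'] at hle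
  omega
/-- **`|v₂(Δ_min W′) − v₂(Δ_min W)| ≤ 6` along a `±2`-twist with BOTH curves additive at `2`** (both minimal
equations then have `a₁, a₃` even, and the half models of `W ⊗ d ≅ W′`, `W′ ⊗ d ≅ W` are integral with
discriminants `2⁶Δ_min`).  Census (TWISTCENSUS2 v1, all `±2` rows with both conductors divisible by `4`):
the jump is `±6` on every row; `±18` occurs only when the twist is semistable at `2`.  IN PRINT (statement):
Pal 2012, Prop. 2.4, clause `d ≡ 2 (mod 4)` (Connell's proposition corrected; it also gives the SIGN of the jump in
closed form from `(v₂c₄, v₂c₆, v₂Δ)` and `2⁻⁶c₆·(d/2) mod 4`), and Barrios et al. 2025, Thm. 5.1, Table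
`localdata-deven` (Kodaira-resolved); the kernel proof below is independent of both (parity lemma + minimality,
no Tate/Kraus case analysis).
[cite: Pal2012, Prop. 2.4 (clause d ≡ 2 mod 4; arXiv:1012.0094 p. 4)] [cite: BarriosEtAl2025, Thm. 5.1, Table localdata-deven] -/
theorem padicValInt_minimalDiscriminantInt_twoTwist_le {d : ℤ} (hd : d = 2 ∨ d = -2)
    {W W' : WeierstrassCurve ℚ} [W.IsElliptic] [W.IsGloballyMinimal] [W'.IsElliptic]
    [W'.IsGloballyMinimal]
    (hW : ¬ W.HasGoodReductionAtPrime 2 ∧ ¬ W.HasMultiplicativeReductionAtPrime 2)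
    (hW' : ¬ W'.HasGoodReductionAtPrime 2 ∧ ¬ W'.HasMultiplicativeReductionAtPrime 2)
    (u : VariableChange ℚ) (hu : u • W.quadraticTwist ((d : ℤ) : ℚ) = W') :
    padicValInt 2 W'.minimalDiscriminantInt ≤ padicValInt 2 W.minimalDiscriminantInt + 6 ∧
    padicValInt 2 W.minimalDiscriminantInt ≤ padicValInt 2 W'.minimalDiscriminantInt + 6 := by
  haveI : Fact (Nat.Prime 2) := ⟨Nat.prime_two⟩
  have hdZ : d ≠ 0 := by rcases hd with rfl | rfl <;> norm_num
  have hd0 : ((d : ℤ) : ℚ) ≠ 0 := by exact_mod_cast hdZ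
  have hvd := padicValInt_two_of_eq_two_or hd
  obtain ⟨h₁, h₃⟩ := even_a₁_and_even_a₃_of_additiveAtTwo W hW.1 hW.2
  obtain ⟨h₁', h₃'⟩ := even_a₁_and_even_a₃_of_additiveAtTwo W' hW'.1 hW'.2
  obtain ⟨C, hC⟩ := exists_smul_quadraticTwist_eq_of_smul_quadraticTwist_eq hd0 u hu
  constructor
  · have h := padicValInt_minimalDiscriminantInt_le_of_smul_quadraticTwist_of_even h₁ h₃ hdZ u hu 2
    rw [hvd] at h; omega
  · have h := padicValInt_minimalDiscriminantInt_le_of_smul_quadraticTwist_of_even h₁' h₃' hdZ C hC 2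
    rw [hvd] at h; omega
/-! ### §29 MAIN THEOREM — Manin near-invariance at `2` (unconditional, sharp) -/

/-- **§29 MAIN THEOREM — MANIN NEAR-INVARIANCE AT `2` ALONG A COMMUTING OPTIMAL `χ±8`-ORBIT (unconditional).**
On a commuting optimal `±2`-pair with `2⁶ ∣ N = N′` (both data lattice-optimal, both equations globally
minimal): EITHER `deg′ = 2·deg` and then `v₂(c′) = v₂(c) ∧ v₂Δ′ = v₂Δ + 6` or `v₂(c′) = v₂(c) + 1 ∧ v₂Δ′ = v₂Δ − 6`,
OR `2·deg′ = deg` and the mirror statement.  So `|v₂(c′) − v₂(c)| ≤ 1` always, and `v₂(c′) = v₂(c)` iff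
degree and discriminant move together — the exact `p = 2` twin of §27. -/
theorem twoTwist_optimal_commuting_manin_near_invariance {d : ℤ} (hd : d = 2 ∨ d = -2) :
    ∀ (W W' : WeierstrassCurve ℚ) [W.IsElliptic] [W.IsGloballyMinimal] [W'.IsElliptic]
      [W'.IsGloballyMinimal] [NeZero (W.conductorNorm ℤ)] [NeZero (W'.conductorNorm ℤ)]
      (u : VariableChange ℚ) (D : ModularParametrizationData W (W.conductorNorm ℤ))
      (D' : ModularParametrizationData W' (W'.conductorNorm ℤ)),
      IsLatticeOptimal D → IsLatticeOptimal D' →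
      2 ^ 6 ∣ W.conductorNorm ℤ → W'.conductorNorm ℤ = W.conductorNorm ℤ →
      u • W.quadraticTwist ((d : ℤ) : ℚ) = W' →
      (D'.modularDegree = 2 * D.modularDegree ∧
        (padicValInt 2 D'.c = padicValInt 2 D.c ∧
            padicValInt 2 W'.minimalDiscriminantInt = padicValInt 2 W.minimalDiscriminantInt + 6 ∨
          padicValInt 2 D'.c = padicValInt 2 D.c + 1 ∧
            padicValInt 2 W'.minimalDiscriminantInt + 6 = padicValInt 2 W.minimalDiscriminantInt)) ∨
      (2 * D'.modularDegree = D.modularDegree ∧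
        (padicValInt 2 D'.c = padicValInt 2 D.c ∧
            padicValInt 2 W.minimalDiscriminantInt = padicValInt 2 W'.minimalDiscriminantInt + 6 ∨
          padicValInt 2 D'.c + 1 = padicValInt 2 D.c ∧
            padicValInt 2 W.minimalDiscriminantInt + 6 = padicValInt 2 W'.minimalDiscriminantInt)) := by
  intro W W' _ _ _ _ _ _ u D D' hD hD' hM hN hu
  haveI : Fact (Nat.Prime 2) := ⟨Nat.prime_two⟩
  have h4 : 2 ^ 2 ∣ W.conductorNorm ℤ := dvd_trans (by norm_num : (2 : ℕ) ^ 2 ∣ 2 ^ 6) hM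
  have h4' : 2 ^ 2 ∣ W'.conductorNorm ℤ := by rw [hN]; exact h4
  have hW := not_good_and_not_mult_of_sq_dvd_conductorNorm W h4
  have hW' := not_good_and_not_mult_of_sq_dvd_conductorNorm W' h4'
  obtain ⟨hle1, hle2⟩ := padicValInt_minimalDiscriminantInt_twoTwist_le hd hW hW' u hu
  rcases twoTwist_optimal_orbit_dichotomy_val hd W W' u D D' hM hN hu hD hD' with
    ⟨hdeg, hv⟩ | ⟨hdeg, hv⟩
  · left
    refine ⟨hdeg, ?_⟩
    omega
  · right
    refine ⟨hdeg, ?_⟩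
    omega

/-- **COROLLARY: `|v₂(c′) − v₂(c)| ≤ 1` on every commuting optimal `χ±8`-pair** (unconditional). -/
theorem twoTwist_optimal_commuting_padicValInt_c_near {d : ℤ} (hd : d = 2 ∨ d = -2) :
    ∀ (W W' : WeierstrassCurve ℚ) [W.IsElliptic] [W.IsGloballyMinimal] [W'.IsElliptic]
      [W'.IsGloballyMinimal] [NeZero (W.conductorNorm ℤ)] [NeZero (W'.conductorNorm ℤ)]
      (u : VariableChange ℚ) (D : ModularParametrizationData W (W.conductorNorm ℤ))
      (D' : ModularParametrizationData W' (W'.conductorNorm ℤ)),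
      IsLatticeOptimal D → IsLatticeOptimal D' →
      2 ^ 6 ∣ W.conductorNorm ℤ → W'.conductorNorm ℤ = W.conductorNorm ℤ →
      u • W.quadraticTwist ((d : ℤ) : ℚ) = W' →
      padicValInt 2 D'.c ≤ padicValInt 2 D.c + 1 ∧ padicValInt 2 D.c ≤ padicValInt 2 D'.c + 1 := by
  intro W W' _ _ _ _ _ _ u D D' hD hD' hM hN hu
  rcases twoTwist_optimal_commuting_manin_near_invariance hd W W' u D D' hD hD' hM hN hu with
    ⟨-, h⟩ | ⟨-, h⟩ <;> omega

/-- **COROLLARY: the minimal discriminant jumps by EXACTLY `6` at `2` along a commuting optimal `χ±8`-pair**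
(census: `Δv₂Δ = ±6` on 28 112 / 28 112 commuting same-conductor `χ₈` rows and 28 112 / 28 112 `χ₋₈` rows). -/
theorem twoTwist_optimal_commuting_padicValInt_Δ_jump {d : ℤ} (hd : d = 2 ∨ d = -2) :
    ∀ (W W' : WeierstrassCurve ℚ) [W.IsElliptic] [W.IsGloballyMinimal] [W'.IsElliptic]
      [W'.IsGloballyMinimal] [NeZero (W.conductorNorm ℤ)] [NeZero (W'.conductorNorm ℤ)]
      (u : VariableChange ℚ) (D : ModularParametrizationData W (W.conductorNorm ℤ))
      (D' : ModularParametrizationData W' (W'.conductorNorm ℤ)),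
      IsLatticeOptimal D → IsLatticeOptimal D' →
      2 ^ 6 ∣ W.conductorNorm ℤ → W'.conductorNorm ℤ = W.conductorNorm ℤ →
      u • W.quadraticTwist ((d : ℤ) : ℚ) = W' →
      padicValInt 2 W'.minimalDiscriminantInt = padicValInt 2 W.minimalDiscriminantInt + 6 ∨
        padicValInt 2 W.minimalDiscriminantInt = padicValInt 2 W'.minimalDiscriminantInt + 6 := by
  intro W W' _ _ _ _ _ _ u D D' hD hD' hM hN hu
  rcases twoTwist_optimal_commuting_manin_near_invariance hd W W' u D D' hD hD' hM hN hu with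
    ⟨-, h⟩ | ⟨-, h⟩ <;> omega

/-- **COROLLARY: MONOTONICITY at `2`** — `deg′ = 2·deg ⇒ v₂(c) ≤ v₂(c′) ≤ v₂(c) + 1` (Manin's conjecture at `2`
DESCENDS along the degree on commuting optimal `χ±8`-pairs). -/
theorem twoTwist_optimal_commuting_padicValInt_c_monotone {d : ℤ} (hd : d = 2 ∨ d = -2) :
    ∀ (W W' : WeierstrassCurve ℚ) [W.IsElliptic] [W.IsGloballyMinimal] [W'.IsElliptic]
      [W'.IsGloballyMinimal] [NeZero (W.conductorNorm ℤ)] [NeZero (W'.conductorNorm ℤ)]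
      (u : VariableChange ℚ) (D : ModularParametrizationData W (W.conductorNorm ℤ))
      (D' : ModularParametrizationData W' (W'.conductorNorm ℤ)),
      IsLatticeOptimal D → IsLatticeOptimal D' →
      2 ^ 6 ∣ W.conductorNorm ℤ → W'.conductorNorm ℤ = W.conductorNorm ℤ →
      u • W.quadraticTwist ((d : ℤ) : ℚ) = W' → D'.modularDegree = 2 * D.modularDegree →
      padicValInt 2 D.c ≤ padicValInt 2 D'.c ∧ padicValInt 2 D'.c ≤ padicValInt 2 D.c + 1 := by
  intro W W' _ _ _ _ _ _ u D D' hD hD' hM hN hu hdeg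
  have hpos : 0 < D.modularDegree := D.deg_pos
  rcases twoTwist_optimal_commuting_manin_near_invariance hd W W' u D D' hD hD' hM hN hu with
    ⟨-, h⟩ | ⟨hdeg', -⟩
  · omega
  · omega
/-! ### Typed leaf E-an-32₂ at `2` (proved) -/

/-- **TYPED LEAF E-an-32₂ (hypothesis-free, PROVED below): MANIN NEAR-INVARIANCE AT `2` along commuting
optimal `χ±8`-twists** (`d = ±2`, `2⁶ ∣ N = N′`): `|v₂(c′) − v₂(c)| ≤ 1`.  Guard `d = 2 ∨ d = −2 →` (vacuous
at every other `d`).  Binder grammar of the cell's twist-orbit leaves, lattice clause inlined. -/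
@[conjecture] def TwoTwistCommutingOrbitManinValNear (d : ℤ) : Prop :=
  d = 2 ∨ d = -2 →
  ∀ (W W' : WeierstrassCurve ℚ) [W.IsElliptic] [W.IsGloballyMinimal] [W'.IsElliptic]
    [W'.IsGloballyMinimal] [NeZero (W.conductorNorm ℤ)] [NeZero (W'.conductorNorm ℤ)]
    (u : VariableChange ℚ) (D : ModularParametrizationData W (W.conductorNorm ℤ))
    (D' : ModularParametrizationData W' (W'.conductorNorm ℤ)),
    (∀ z ∈ D.L.lattice, ∃ w ∈ periodLattice D.f, z = D.c * w) →
    (∀ z ∈ D'.L.lattice, ∃ w ∈ periodLattice D'.f, z = D'.c * w) →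
    2 ^ 6 ∣ W.conductorNorm ℤ → W'.conductorNorm ℤ = W.conductorNorm ℤ →
    u • W.quadraticTwist ((d : ℤ) : ℚ) = W' →
    padicValInt 2 D'.c ≤ padicValInt 2 D.c + 1 ∧ padicValInt 2 D.c ≤ padicValInt 2 D'.c + 1

/-- E-an-32₂ PROVED. -/
theorem twoTwistCommutingOrbitManinValNear_holds (d : ℤ) : TwoTwistCommutingOrbitManinValNear d := by
  intro hd W W' _ _ _ _ _ _ u D D' hD hD' hM hN hu
  exact twoTwist_optimal_commuting_padicValInt_c_near hd W W' u D D' hD hD' hM hN hu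

end NearInvarianceAtTwo

end Summit.BirchSwinnertonDyer.Rank1Residual.ManinAdditive

end
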